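import Summits.Ventures.PercRepro.RankLevelSetRuleQSliceBand

/-!
# PercRepro — THE SQUARE-ROOT BAND WITH ITS TWO NATURAL HYPOTHESES (night-1, gen 22; dossier §33)

`slice_band` asked for `4(u+k)² ≤ q − u`. The step `band_step` only needs `4u² ≤ m` (for `u·(2J_2(m)) ≤ 1/2`) and
`(u+k)² ≤ m + 2` (for `C(u+k, k−1)·J_k(m) ≤ 1/4`), both monotone along the climb; so the band is really
`k − 1 ≤ u`, `4u² ≤ q − u`, `(u+k)² ≤ q − u + 2` — for `u ≥ k` the first condition is the binding one, `u ≤ √(q−u)/2`: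
* **`slice_band_sharp`** — `Φ(q+k, q) ≤ R̂(q, k, q − u)` under these hypotheses (every family `k ≥ 5`);
* **`ruleQRecv_ge_phiK_band_sharp`** — the matroid level.
Axioms: standard.
-/

namespace PercRepro

open Finset

/-- The climb with the two natural hypotheses, by induction on the distance above the first untruncated slice. -/
theorem slice_band_sharp_aux (k : ℕ) (hk : 5 ≤ k) (t : ℕ) :
    ∀ m : ℕ, 4 * (k - 1 + t) ^ 2 ≤ m → (k - 1 + t + k) ^ 2 ≤ m + 2 →
      phiK (m + (k - 1 + t) + k) (m + (k - 1 + t)) ≤ rhat (m + (k - 1 + t)) k m := by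
  induction t with
  | zero =>
    intro m _ _
    have := first_untrunc_slice_every k (m + (k - 1 + 0)) hk (by omega)
    rwa [show m + (k - 1 + 0) - (k - 1) = m by omega] at this
  | succ t ih =>
    intro m hm1 hm2
    have hmono1 : (k - 1 + t) ^ 2 ≤ (k - 1 + (t + 1)) ^ 2 := Nat.pow_le_pow_left (by omega) 2
    have hmono2 : (k - 1 + t + k) ^ 2 ≤ (k - 1 + (t + 1) + k) ^ 2 := Nat.pow_le_pow_left (by omega) 2
    have h1 := ih (m + 1) (by omega) (by omega)
    have h2 := rhat_le_sliceL_of_untrunc (m + 1 + (k - 1 + t)) k (m + 1) (by omega)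
    have hstep := band_step k (k - 1 + t) m hk (by omega) (by omega)
    rw [show m + (k - 1 + (t + 1)) = m + 1 + (k - 1 + t) by omega]
    have h1' : phiK (m + 1 + (k - 1 + t) + k) (m + 1 + (k - 1 + t))
        ≤ ∑ j ∈ Finset.Ioo 0 k, ((m + 1 + (k - 1 + t) + k - (m + 1)).choose j : ℚ)
            * ∑ a ∈ range (m + 1 + 1), ((m + 1).choose a : ℚ) / ((m + 1 + (k - 1 + t) + j + a).choose (a + j) : ℚ) :=
      h1.trans h2
    exact phiK_le_rhat_of_sliceStep (k - 1 + t) k m (by omega) h1' hstep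

/-- **THE SQUARE-ROOT BAND, SHARP FORM**: for every family `k ≥ 5`, every slice `k − 1 ≤ u ≤ q` with `4u² ≤ q − u` and
`(u+k)² ≤ q − u + 2` is paid on the cell `(q+k, q)`. -/
theorem slice_band_sharp (k u q : ℕ) (hk : 5 ≤ k) (hu : k - 1 ≤ u) (huq : u ≤ q) (h1 : 4 * u ^ 2 ≤ q - u)
    (h2 : (u + k) ^ 2 ≤ q - u + 2) :
    phiK (q + k) q ≤ rhat q k (q - u) := by
  obtain ⟨t, rfl⟩ : ∃ t, u = k - 1 + t := ⟨u - (k - 1), by omega⟩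
  obtain ⟨m, rfl⟩ : ∃ m, q = m + (k - 1 + t) := ⟨q - (k - 1 + t), by omega⟩
  rw [show m + (k - 1 + t) - (k - 1 + t) = m by omega] at h1 h2 ⊢
  exact slice_band_sharp_aux k hk t m h1 h2

/-- **THE MATROID LEVEL OF THE SHARP BAND**. -/
theorem ruleQRecv_ge_phiK_band_sharp {β : Type} (M : Matroid β) [M.Finite] {q k u : ℕ} (hk : 5 ≤ k) (hu : k - 1 ≤ u)
    (huq : u ≤ q) (h1 : 4 * u ^ 2 ≤ q - u) (h2 : (u + k) ^ 2 ≤ q - u + 2) (hE : M.E.ncard = (q + k) + q) {Z : Set β}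
    (hZ : Z ∈ cellMembers M (q + k) q) (hP : (flatPart M Z).ncard = q - u) :
    phiK (q + k) q ≤ ruleQRecv M (q + k) q Z := by
  have h := slice_band_sharp k u q hk hu huq h1 h2
  have h' := rhat_le_ruleQRecv M hE hZ
  rw [hP] at h'
  exact h.trans h'

end PercRepro
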